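import Literature.NumberTheory.EllipticCurves.AnticyclotomicSignedSelmerRelaxedEquality
import HarnessLib

/-!
# Castella–Wan 2024, proof of Thm. 6.8 (MS p. 30): the sentence "`Sel_±(K, 𝐓^ac) = Sel^{±,rel}(K, 𝐓^ac)`"
# REDUCED to its two printed inputs (rank one of `Sel^{±,rel}` and torsion-freeness of the quotient) —
# the module-theoretic step PROVED on the tree's carriers

`Proofs`-style companion of `AnticyclotomicSignedSelmerRelaxedEquality.lean` (the named fact
`castellaWan2024_proofThm68_selmerRel_le_selmerSgn`, INPUTS row G67 of the BSD cell `pub/bsd-wall/bsd-inputs`;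
consumer: crux `AnticyclotomicEisensteinDivisibility`, stmt-BirchSwinnertonDyer-20727, `stub_namedFactsSS` conj. 7).
THEOREMS ONLY (no definition, no named fact, no instance, no `sorry`). Written by the literature-prover seat
`bsd-input-cw24-lem67-thm68` (LADDER-BSD inputs→unconditional). HONEST FRAMING: this file does NOT discharge the
fact; it isolates, as a kernel-checked theorem, the ONE step of the printed proof that is module algebra, so that
the fact is closed MODULO exactly the two arithmetic inputs print invokes (typed inline as hypotheses, in the
tree's currency; no new `def … : Prop`). No summit statement (Birch–Swinnerton-Dyer) is proved by this file.

## The printed argument (Castella–Wan, accepted MS `paper:url-7157bd4f7b88`, proof of Thm. 6.8, MS p. 30 =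
## journal p. 2624; displayed with proof as Lemma 5.9 of arXiv:1607.02019v3, held TeX p. 20)

"… either of the rank hypotheses in (i) or (ii) implies that both `Sel_±(K, 𝐓^ac)` and `Sel^{±,rel}(K, 𝐓^ac)`
have `Λ^ac`-rank one, and hence `Sel_±(K, 𝐓^ac) = Sel^{±,rel}(K, 𝐓^ac)`, since the quotient
`Sel^{±,rel}(K, 𝐓^ac)/Sel_±(K, 𝐓^ac)` injects into `H¹(K_𝔭̄, 𝐓^ac)/H¹_±(K_𝔭̄, 𝐓^ac)`, which has trivial
`Λ^ac`-torsion by Proposition 3.8." Earlier in the same proof (MS p. 30): "`E(K_∞)[p^∞] = 0`, which by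
[PR00, §1.3.3] implies that the `Λ^ac`-torsion submodule of `H¹(K, 𝐓^ac)` is trivial".

So the sentence is: (A) `Sel^{±,rel}` torsion-free of rank one, (B) `Sel_±` of rank one (a HYPOTHESIS of the
fact, from (i)), (C) `Sel_±` is `Λ`-saturated in `Sel^{±,rel}` (a submodule of a module with torsion-free
quotient) ⟹ `Sel^{±,rel} ≤ Sel_±`. The implication "(A) ∧ (B) ∧ (C) ⟹ ≤" is the theorem
`selmerLambdaAdic_le_of_finrank_eq_one_of_saturated` below (for ANY two comparable families of level
conditions), and `castellaWan2024_proofThm68_selmerRel_le_selmerSgn_of_rankOne_of_saturated` feeds it into the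
fact's binder block. What remains for a `_holds` (NOT proved here, recorded as the hypotheses `hA`, `hC`):
(A) = "(6.12) + Lemma 6.7 + Cor. 6.4 + Prop. 3.8 ⟹ `rank Sel^{±,rel} = 1`" together with [PR00, §1.3.3]
torsion-freeness, and (C) = "the quotient injects into `H¹(K_𝔭̄, 𝐓^ac)/H¹_±`" + Prop. 3.8 — local and global
`Λ`-adic duality statements the tree does not have as theorems (the sibling structure `TransferInputs`
records (6.12)/(6.13)/[PR00] as hypotheses for the same reason).

## Contents

* §1 (pure algebra) `exists_smul_add_smul_eq_zero_of_finrank_eq_one`: over a nontrivial commutative ring, in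
  a module of `finrank` one any two elements are linearly dependent (and a private non-vanishing helper).
* §2 `selmerLambdaAdic_le_of_finrank_eq_one_of_saturated`: for level-condition families `𝓛 ≤ 𝓛'` (i.e.
  `Sel^{𝓛}(K, 𝐓^ac) ≤ Sel^{𝓛'}(K, 𝐓^ac)` as subgroups of `∏_{n,m} H¹(K_n, E[p^m])`, both with the
  CONSTRUCTED `ℤ_p⟦T⟧`-structures `selmerLambdaAdic.moduleOfGen hγ`, which are the same truncated action
  `tsmul` on families): `Sel^{𝓛'}` torsion-free of `finrank` one, `Sel^{𝓛}` of `finrank` one and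
  `Λ`-saturated in `Sel^{𝓛'}` ⟹ `Sel^{𝓛'} ≤ Sel^{𝓛}`.
* §3 `castellaWan2024_proofThm68_selmerRel_le_selmerSgn_of_rankOne_of_saturated`: the named fact from
  (A) and (C) stated under the fact's own binders (so WEAKER hypotheses than print's sentences would be
  are not used: (A) and (C) are exactly print's two inputs, (C) in the consequence form "saturated").

References: [CastellaWan2023] proof of Thm. 6.8 (MS p. 30), Prop. 3.8 (MS p. 15), Def. 5.1 (MS p. 23), §6
standing hypotheses (MS p. 25); arXiv:1607.02019v3 Lemma 5.9 (p. 20 of the held TeX); [PerrinRiou1995Asterisque]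
§1.3.3 (cited through Castella–Wan).
-/

noncomputable section

open scoped Classical

open PowerSeries NumberField IsDedekindDomain Field
open Literature.NumberTheory.EllipticCurves Literature.NumberTheory.GaloisRepresentations
open Literature.NumberTheory.EllipticCurves.ModularForms Literature.NumberTheory.EllipticCurves.Castella2018

universe u

namespace Literature.NumberTheory.EllipticCurves.AcSigned

/-! ## §1 Two elements of a module of rank one are dependent (pure algebra) -/

section RankOne

variable {R : Type*} [CommRing R] [Nontrivial R] {M : Type*} [AddCommGroup M] [Module R M]

/-- In a module with `Module.finrank R M = 1` over a nontrivial commutative ring, ANY two elements are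
linearly dependent: `finrank = 1` forces `Module.rank R M = 1`, while an independent pair would give
`2 ≤ Module.rank R M` (`LinearIndependent.cardinal_le_rank`). No finiteness hypothesis.
[cite: CastellaWan2023, proof of Thm. 6.8 (MS p. 30), "both … have `Λ^ac`-rank one"] -/
theorem exists_smul_add_smul_eq_zero_of_finrank_eq_one (h : Module.finrank R M = 1) (x y : M) :
    ∃ s t : R, (s ≠ 0 ∨ t ≠ 0) ∧ s • x + t • y = 0 := by
  by_contra hc
  push Not at hc
  have hli : LinearIndependent R ![x, y] := by
    rw [LinearIndependent.pair_iff]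
    intro s t hst
    by_contra hst'
    rcases not_and_or.1 hst' with hs | ht
    · exact hc s t (Or.inl hs) hst
    · exact hc s t (Or.inr ht) hst
  have hrank : Module.rank R M = 1 := Cardinal.toNat_eq_one.1 h
  have h2 := hli.cardinal_lift_le_rank
  rw [hrank, Cardinal.mk_fintype, Fintype.card_fin, Cardinal.lift_natCast, ← Nat.cast_one,
    Cardinal.lift_natCast] at h2
  exact absurd (Nat.cast_le.1 h2) (by omega)

/-- A module with `Module.finrank R M = 1` has a non-zero element (private helper). [folklore] -/
private theorem exists_ne_zero_of_finrank_eq_one (h : Module.finrank R M = 1) : ∃ x : M, x ≠ 0 := by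
  haveI := Module.nontrivial_of_finrank_eq_succ (R := R) (n := 0) h
  exact exists_ne (0 : M)

end RankOne

/-! ## §2 Rank one + rank one + saturated ⟹ equality, on the compact carriers `Sel^{𝓛}(K, 𝐓^ac)` -/

section Saturated

variable {K : Type u} [Field K] [NumberField K] {W : WeierstrassCurve K} {p : ℕ} [Fact p.Prime]
  {κ : ZpExtension K p} {γ : absoluteGaloisGroup K}

/-- **Rank one inside rank one with torsion-free quotient is everything.** Let `𝓛, 𝓛'` be two families of
condition types above `p` with `Sel^{𝓛}(K, 𝐓^ac) ≤ Sel^{𝓛'}(K, 𝐓^ac)` (`selmerLambdaAdic`, e.g. by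
`selmerLambdaAdic_le_of_rel`), both carrying the constructed `Λ = ℤ_p⟦T⟧`-structures of the topological
generator `γ` (the SAME truncated action `tsmul` on the underlying families, `lambdaAdic.smul_apply`). If
`Sel^{𝓛'}` has no `Λ`-torsion and `finrank_Λ = 1`, `Sel^{𝓛}` has `finrank_Λ = 1`, and `Sel^{𝓛}` is
`Λ`-saturated in `Sel^{𝓛'}` (`f ≠ 0`, `f·x ∈ Sel^{𝓛}` ⟹ `x ∈ Sel^{𝓛}` — the consequence of "the quotient
injects into a module with trivial `Λ`-torsion"), then `Sel^{𝓛'} ≤ Sel^{𝓛}`. Proof (print's "and hence"):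
pick `0 ≠ n ∈ Sel^{𝓛}`; for `x ∈ Sel^{𝓛'}` a dependence `s·x + t·n = 0` has `s ≠ 0` (else `t·n = 0`, `t ≠ 0`,
contradicting torsion-freeness), so `s·x = −t·n ∈ Sel^{𝓛}` and saturation gives `x ∈ Sel^{𝓛}`.
[cite: CastellaWan2023, proof of Thm. 6.8 (MS p. 30); arXiv:1607.02019v3 Lemma 5.9] -/
theorem selmerLambdaAdic_le_of_finrank_eq_one_of_saturated (hγ : κ.IsTopGenerator γ)
    {L L' : HeightOneSpectrum (𝓞 K) → PCond}
    (hle : selmerLambdaAdic W p κ γ L ≤ selmerLambdaAdic W p κ γ L')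
    (hTF : ∀ (f : IwasawaAlgebra p) (x : selmerLambdaAdic W p κ γ L'),
      (letI := selmerLambdaAdic.moduleOfGen W p κ γ hγ L'; f • x) = 0 → f = 0 ∨ x = 0)
    (hrk' : letI := selmerLambdaAdic.moduleOfGen W p κ γ hγ L'
      Module.finrank (IwasawaAlgebra p) (selmerLambdaAdic W p κ γ L') = 1)
    (hrk : letI := selmerLambdaAdic.moduleOfGen W p κ γ hγ L
      Module.finrank (IwasawaAlgebra p) (selmerLambdaAdic W p κ γ L) = 1)
    (hsat : ∀ (f : IwasawaAlgebra p), f ≠ 0 → ∀ x : selmerLambdaAdic W p κ γ L',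
      (letI := selmerLambdaAdic.moduleOfGen W p κ γ hγ L'; (f • x).1) ∈ selmerLambdaAdic W p κ γ L →
        x.1 ∈ selmerLambdaAdic W p κ γ L) :
    selmerLambdaAdic W p κ γ L' ≤ selmerLambdaAdic W p κ γ L := by
  letI instL' := selmerLambdaAdic.moduleOfGen W p κ γ hγ L'
  -- the action on `Sel^{𝓛'}` is the truncated action `tsmul` on the underlying families (definitional)
  have hval : ∀ (g : IwasawaAlgebra p) (y : selmerLambdaAdic W p κ γ L'), (g • y).1 = tsmul W p κ γ g y.1 :=
    fun _ _ ↦ rfl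
  -- a non-zero element of `Sel^{𝓛}`, seen in `Sel^{𝓛'}`
  obtain ⟨n, hn⟩ : ∃ n : selmerLambdaAdic W p κ γ L, n ≠ 0 := by
    letI := selmerLambdaAdic.moduleOfGen W p κ γ hγ L
    exact exists_ne_zero_of_finrank_eq_one hrk
  have hn1 : n.1 ≠ 0 := fun h ↦ hn (Subtype.ext h)
  set n' : selmerLambdaAdic W p κ γ L' := ⟨n.1, hle n.2⟩ with hn'def
  have hn' : n' ≠ 0 := fun h ↦ hn1 (congrArg Subtype.val h)
  intro x hx
  obtain ⟨s, t, hst, hrel⟩ := exists_smul_add_smul_eq_zero_of_finrank_eq_one hrk' ⟨x, hx⟩ n'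
  -- `s ≠ 0`: otherwise `t • n' = 0` with `t ≠ 0`, contradicting torsion-freeness
  have hs : s ≠ 0 := by
    rintro rfl
    rw [zero_smul, zero_add] at hrel
    rcases hTF t n' hrel with ht | h0
    · rcases hst with h | h
      · exact h rfl
      · exact h ht
    · exact hn' h0
  -- `s • x = -(t • n')`, and `(t • n')` is the family `tsmul t n`, which lies in `Sel^{𝓛}` (`tsmul_mem`)
  have htn : (t • n').1 ∈ selmerLambdaAdic W p κ γ L := by
    rw [hval]
    exact tsmul_mem hγ (fun _ _ _ hy ↦ conjH1_mem_selmerTorsion γ hy) t n.2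
  have hsx : (s • (⟨x, hx⟩ : selmerLambdaAdic W p κ γ L')).1 ∈ selmerLambdaAdic W p κ γ L := by
    rw [eq_neg_of_add_eq_zero_left hrel]
    exact neg_mem htn
  exact hsat s hs ⟨x, hx⟩ hsx

end Saturated

/-! ## §3 The named fact modulo its two printed inputs -/

section Fact

variable {N : ℕ} [NeZero N] {W : WeierstrassCurve ℚ} [W.IsGloballyMinimal] {K : Type} [Field K]
  [NumberField K] {p : ℕ} [Fact p.Prime] {κ : ZpExtension K p} {𝔭 𝔭' : HeightOneSpectrum (𝓞 K)}

omit [W.IsGloballyMinimal] in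
/-- `Sel_ε(K, 𝐓^ac) ≤ Sel^{ε, rel at 𝔭'}(K, 𝐓^ac)`: relaxing the condition at `𝔭'`
(`selmerLambdaAdic_le_of_rel`). [cite: CastellaWan2023, Def. 5.1 and proof of Thm. 6.8 (MS pp. 23, 30)] -/
theorem selmerLambdaAdic_sgn_le_atRel (γ : absoluteGaloisGroup K) (ε : ℤˣ) :
    selmerLambdaAdic (W.baseChange K) p κ γ (fun _ ↦ .sgn ε) ≤
      selmerLambdaAdic (W.baseChange K) p κ γ (PCond.at 𝔭' .rel (.sgn ε)) :=
  selmerLambdaAdic_le_of_rel fun v _ ↦ by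
    by_cases hv : v = 𝔭'
    · subst hv; exact Or.inr (PCond.at_self _ _ _)
    · exact Or.inl (PCond.at_of_ne _ _ hv)

/-- **Castella–Wan's sentence "`Sel_±(K, 𝐓^ac) = Sel^{±,rel}(K, 𝐓^ac)`" (proof of Thm. 6.8, MS p. 30) —
the named fact `castellaWan2024_proofThm68_selmerRel_le_selmerSgn` — MODULO its two printed inputs**, each
taken under the fact's own binder block (the `Setting`, `N = N_E`, `N⁻ = 1`, `3 < p`, the newform and the
embedding datum, a topological generator `γ`, a sign `ε`, and the rank hypotheses of Thm. 6.8 (i):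
`finrank_Λ Sel_ε(K, 𝐓^ac) = 1`, `X_ε` of rank one):
* `hA` — "both `Sel_±(K, 𝐓^ac)` and `Sel^{±,rel}(K, 𝐓^ac)` have `Λ^ac`-rank one" (for `Sel^{±,rel}`; print:
  from (6.12), Lemma 6.7, Lemma 4.7 + Cor. 6.4, Prop. 3.8) AND "the `Λ^ac`-torsion submodule of `H¹(K, 𝐓^ac)`
  is trivial" ([PR00, §1.3.3]) for `Sel^{±,rel} ⊆ H¹(K, 𝐓^ac)`: `Sel^{ε,rel at 𝔭'}` is torsion-free with
  `finrank_Λ = 1`;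
* `hC` — "the quotient `Sel^{±,rel}/Sel_±` injects into `H¹(K_𝔭̄, 𝐓^ac)/H¹_±(K_𝔭̄, 𝐓^ac)`, which has trivial
  `Λ^ac`-torsion by Proposition 3.8", in its consequence form: `Sel_ε` is `Λ`-saturated in `Sel^{ε,rel at 𝔭'}`.
Given these, the fact follows by `selmerLambdaAdic_le_of_finrank_eq_one_of_saturated`. This closes INPUTS row
G67 MODULO `hA ∧ hC` and nothing more; BSD is not proved by this.
[cite: CastellaWan2023, proof of Thm. 6.8 (MS p. 30), Prop. 3.8 (MS p. 15); arXiv:1607.02019v3 Lemma 5.9]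
[cite: PerrinRiou1995Asterisque, §1.3.3 (cited through CastellaWan2023, MS p. 30)] -/
theorem castellaWan2024_proofThm68_selmerRel_le_selmerSgn_of_rankOne_of_saturated
    (hA : ∀ (_ : Setting W K p κ 𝔭 𝔭') (ι : PadicAlgCl p ≃+* ℂ) {f : CuspForm (CongruenceSubgroup.Gamma0 N) 2}
      (_ : IsNewformOf W f), (W.conductorNorm ℤ : ℕ) = N → SatisfiesHeegnerHypothesis N K → 3 < p →
      (∀ (w : InfinitePlace K) (k : 𝓞 K), k ∈ 𝔭.asIdeal ↔ ‖ι.symm (w.embedding (k : K))‖ < 1) →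
      ∀ (γ : absoluteGaloisGroup K) (hγ : κ.IsTopGenerator γ) (ε : ℤˣ),
        (letI := selmerLambdaAdic.moduleOfGen (W.baseChange K) p κ γ hγ (fun _ ↦ PCond.sgn ε)
         Module.finrank (IwasawaAlgebra p) (selmerLambdaAdic (W.baseChange K) p κ γ (fun _ ↦ .sgn ε)) = 1) →
        X.HasRank (W.baseChange K) p κ ∅ (fun _ ↦ .sgn ε) hγ 1 →
        (∀ (g : IwasawaAlgebra p) (x : selmerLambdaAdic (W.baseChange K) p κ γ (PCond.at 𝔭' .rel (.sgn ε))),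
          (letI := selmerLambdaAdic.moduleOfGen (W.baseChange K) p κ γ hγ (PCond.at 𝔭' .rel (.sgn ε)); g • x) =
            0 → g = 0 ∨ x = 0) ∧
        (letI := selmerLambdaAdic.moduleOfGen (W.baseChange K) p κ γ hγ (PCond.at 𝔭' .rel (.sgn ε))
         Module.finrank (IwasawaAlgebra p)
           (selmerLambdaAdic (W.baseChange K) p κ γ (PCond.at 𝔭' .rel (.sgn ε))) = 1))
    (hC : ∀ (_ : Setting W K p κ 𝔭 𝔭') (ι : PadicAlgCl p ≃+* ℂ) {f : CuspForm (CongruenceSubgroup.Gamma0 N) 2}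
      (_ : IsNewformOf W f), (W.conductorNorm ℤ : ℕ) = N → SatisfiesHeegnerHypothesis N K → 3 < p →
      (∀ (w : InfinitePlace K) (k : 𝓞 K), k ∈ 𝔭.asIdeal ↔ ‖ι.symm (w.embedding (k : K))‖ < 1) →
      ∀ (γ : absoluteGaloisGroup K) (hγ : κ.IsTopGenerator γ) (ε : ℤˣ),
        (letI := selmerLambdaAdic.moduleOfGen (W.baseChange K) p κ γ hγ (fun _ ↦ PCond.sgn ε)
         Module.finrank (IwasawaAlgebra p) (selmerLambdaAdic (W.baseChange K) p κ γ (fun _ ↦ .sgn ε)) = 1) →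
        X.HasRank (W.baseChange K) p κ ∅ (fun _ ↦ .sgn ε) hγ 1 →
        ∀ (g : IwasawaAlgebra p), g ≠ 0 →
          ∀ x : selmerLambdaAdic (W.baseChange K) p κ γ (PCond.at 𝔭' .rel (.sgn ε)),
            (letI := selmerLambdaAdic.moduleOfGen (W.baseChange K) p κ γ hγ (PCond.at 𝔭' .rel (.sgn ε))
             (g • x).1) ∈ selmerLambdaAdic (W.baseChange K) p κ γ (fun _ ↦ .sgn ε) →
            x.1 ∈ selmerLambdaAdic (W.baseChange K) p κ γ (fun _ ↦ .sgn ε)) :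
    castellaWan2024_proofThm68_selmerRel_le_selmerSgn N W K p κ 𝔭 𝔭' := by
  intro hS ι f hf hN hH hp hι γ hγ ε hrk hX
  obtain ⟨hTF, hrk'⟩ := hA hS ι hf hN hH hp hι γ hγ ε hrk hX
  exact selmerLambdaAdic_le_of_finrank_eq_one_of_saturated hγ (selmerLambdaAdic_sgn_le_atRel γ ε) hTF hrk'
    hrk (hC hS ι hf hN hH hp hι γ hγ ε hrk hX)

end Fact

end Literature.NumberTheory.EllipticCurves.AcSigned

end
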